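import Summits.QuantumAdvantage.QuantumAdvantage.Theorems.LinnikCubicClassGroupsDegreeOnePrimesEscapeFrobeniusWindow
import Summits.QuantumAdvantage.QuantumAdvantage.Theorems.LinnikCubicClassGroupsDegreeOnePrimesEscapeFrobeniusSmoothedSignedAll
import HarnessLib

/-!
# The smoothed Chebotarev theorem for a cyclic extension in SHORT INTERVALS, with the exceptional sign

Topic `Summits/QuantumAdvantage/QuantumAdvantage/Theorems`, cell B2b-1 (linnik-cubic), PART A (gen 17); helper
toward the crux `DegreeOnePrimesEscape` (stmt-QuantumAdvantage-11543) of route `LinnikCubicClassGroups` — the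
CHEBOTAREV DENSITY THEOREM IN SHORT INTERVALS for conjugacy classes, smoothed form.  HONEST FRAMING: the value
of this file is a THEOREM (kernel-checked, GRH-free) — NOT summit progress.

For a cyclic Galois extension `N|E` of number fields with `[N:ℚ] = n₀`, `τ ∈ Gal(N|E)` and the Frobenius indicator
`w_τ(𝔭^k) = [𝔭 unramified, Frob_𝔭^k = τ]`, the smoothed sum `ψ̃_τ(g) = Σ_k Λ_{w_τ}(k) g(log k)` against the window
weight `g = windowTest lo hi (ε₀η)` (`log x ≤ lo < hi ≤ log x + η`, `x^{−θ/8} ≤ 2η ≤ 2 log 2`) satisfies, for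
`x ≥ Q^{a₁}` (`Q = |d_N| n₀^{n₀}`), with `m = [N:E]`, `F` the Laplace transform of `g` and a faithful character
`χ₁` of `Gal(N|E)`:
(A) no real zero of `ζ₁_N` in the `c`-window ⟹ `‖m ψ̃_τ(g) − F(−1)‖ ≤ κ x η + n₀ ω(d_N)(log x + 2)`;
(B) `β₁` such a zero ⟹ `‖m ψ̃_τ(g) − F(−1) + χ₁(τ)^{−j₀} F(−β₁)‖ ≤ κ x η + n₀ ω(d_N)(log x + 2)` for some
`j₀ < m` (depending on the window);
(B') `β₁` in the smaller `c'`-window ⟹ the same with ONE index `j₀ < m` for all windows and all `τ`, and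
`j₀ = 0 ↔ ζ₁_E(β₁) = 0`, `(χ₁(τ)^{j₀})² = 1` (the exceptional character is real: the coefficient is `+1` for all
`τ` iff `ζ_E(β₁) = 0`, else `−1` exactly off the index-2 subgroup).
Proof: `frobWindow_dichotomy` for the primitive Hecke factorisation of `ζ_N/ζ_E`
(`CyclicExtension.exists_primitive_heckeFactorisation`), Deuring's reduction at the level of coefficients
(`norm_sum_coefFordK_sub_le`, any weight), the ramified junk `ψ_ram(e^{hi+ε}) ≤ [E:ℚ] ω(d_N)(hi + ε)`
(`psiWeighted_ram_le`), Landau–Page simplicity and `…HeckeConjugateIndex` for the sign.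
References: [LagariasMontgomeryOdlyzko1979, §§3, 7]; [ThornerZaman2019, Thm. 3.1]; A. Balog, K. Ono, J. Number
Theory 91 (2001); S. Gun, S. L. Naik, arXiv:2405.04698 (2024), Thm. 7.
-/

noncomputable section

open Complex Real Finset NumberField IsDedekindDomain
open scoped NumberField nonZeroDivisors Classical

namespace Summit.QuantumAdvantage.QuantumAdvantage.Theorems.DegreeOnePrimesEscape

open Literature.NumberTheory.LFunctions Literature.NumberTheory.LFunctions.NumberField
  Literature.NumberTheory.LFunctions.EntireEF Literature.NumberTheory.LFunctions.WindowWeight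
  Literature.NumberTheory.LFunctions.AbelianDensity Literature.NumberTheory.GaloisRepresentations

/-! ### Smoothed sums against a bounded weight vanishing beyond `X` -/

/-- **`ψ̃_w(g) ≤ ψ_w(e^{X})`** for a weight `0 ≤ g ≤ 1` vanishing on `[X, ∞)` and `w ≥ 0`. -/
theorem smoothedPsiWeighted_le_psiWeighted_exp {K : Type} [Field K] [NumberField K] {w : Ideal (𝓞 K) → ℝ}
    (hw : ∀ I, 0 ≤ w I) {g : ℝ → ℝ} {X : ℝ} (hg01 : ∀ u, g u ∈ Set.Icc (0 : ℝ) 1)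
    (hg : ∀ u, X ≤ u → g u = 0) :
    (∑' n : ℕ, (∑ I ∈ idealsOfNorm K n, w I * idealVonMangoldt I) * g (Real.log n)) ≤
      (∑ n ∈ Icc 0 ⌊Real.exp X⌋₊, ∑ I ∈ idealsOfNorm K n, w I * idealVonMangoldt I) := by
  set M : ℕ := ⌊Real.exp X⌋₊ + 1 with hM
  have hM1 : 1 ≤ M := by omega
  have hMlog : X ≤ Real.log M := by
    have h1 : Real.exp X ≤ M := by rw [hM]; push_cast; exact (Nat.lt_floor_add_one _).le
    have := Real.log_le_log (Real.exp_pos X) h1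
    rwa [Real.log_exp] at this
  rw [smoothedPsiWeighted_eq_sum w hg hM1 hMlog]
  have hrange : Finset.range M = Icc 0 ⌊Real.exp X⌋₊ := by
    ext n; rw [Finset.mem_range, mem_Icc, hM]; omega
  rw [hrange]
  refine Finset.sum_le_sum fun n _ ↦ ?_
  have h01 := hg01 (Real.log n)
  have h0 := vonMangoldtWeighted_nonneg (K := K) hw n
  nlinarith [h01.2]

/-! ### Uniqueness of the index carrying a simple zero -/

/-- If `o_E + Σ_{0<j<m} o_j = 1`, the index carrying the `1` is unique. -/
theorem carrier_index_unique {m : ℕ} {oE : ℕ} {o : ℕ → ℕ}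
    (hsum1 : oE + ∑ j ∈ Finset.Ico 1 m, o j = 1) {j₀ j₁ : ℕ} (hj₀ : j₀ < m) (hj₁ : j₁ < m)
    (h₀ : (j₀ = 0 ∧ oE = 1) ∨ (0 < j₀ ∧ o j₀ = 1)) (h₁ : (j₁ = 0 ∧ oE = 1) ∨ (0 < j₁ ∧ o j₁ = 1)) :
    j₀ = j₁ := by
  have hle : ∀ {j}, 0 < j → j < m → o j ≤ ∑ i ∈ Finset.Ico 1 m, o i := fun hj hjm ↦
    Finset.single_le_sum (f := o) (fun _ _ ↦ Nat.zero_le _) (Finset.mem_Ico.mpr ⟨hj, hjm⟩)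
  rcases h₀ with ⟨rfl, hE⟩ | ⟨hpos₀, ho₀⟩ <;> rcases h₁ with ⟨rfl, hE'⟩ | ⟨hpos₁, ho₁⟩
  · rfl
  · have := hle hpos₁ hj₁; omega
  · have := hle hpos₀ hj₀; omega
  · by_contra hne
    have h2 : o j₀ + o j₁ ≤ ∑ i ∈ Finset.Ico 1 m, o i := by
      have hsub : ({j₀, j₁} : Finset ℕ) ⊆ Finset.Ico 1 m := by
        intro i hi
        rcases Finset.mem_insert.mp hi with rfl | hi
        · exact Finset.mem_Ico.mpr ⟨hpos₀, hj₀⟩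
        · rw [Finset.mem_singleton] at hi; subst hi; exact Finset.mem_Ico.mpr ⟨hpos₁, hj₁⟩
      have := Finset.sum_le_sum_of_subset_of_nonneg hsub (fun i _ _ ↦ Nat.zero_le (o i))
      rwa [Finset.sum_pair hne] at this
    omega

set_option maxHeartbeats 3200000 in
/-- **The smoothed Chebotarev theorem for a cyclic extension in short intervals, two-sided, with the exceptional
zero of `ζ_N` and the SIGN of its coefficient** (see the module docstring). [cite: LagariasMontgomeryOdlyzko1979, §7]
[cite: ThornerZaman2019, Theorem 3.1] -/
theorem smoothedFrobeniusWindow_dichotomy_signed (n₀ : ℕ) (hn₀ : 1 < n₀) {κ : ℝ} (hκ : 0 < κ)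
    {ε₀ : ℝ} (hε₀ : 0 < ε₀) (hε₀1 : ε₀ ≤ 1 / 4) :
    ∃ θ a₁ c c' : ℝ, 0 < θ ∧ θ ≤ 1 / 8 ∧ 1 ≤ a₁ ∧ 0 < c ∧ c ≤ 1 / (8 * ((n₀ : ℝ) ^ 2 + 1)) ∧
      0 < c' ∧ c' ≤ c ∧
    ∀ (E N : Type) [Field E] [NumberField E] [Field N] [NumberField N] [Algebra E N] [IsGalois E N]
      [IsCyclic (N ≃ₐ[E] N)], Module.finrank ℚ N = n₀ →
    ∃ χ₁ : (N ≃ₐ[E] N) →* ℂˣ, Function.Injective χ₁ ∧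
      (∀ (τ : N ≃ₐ[E] N) (wτ : Ideal (𝓞 E) → ℝ),
        (∀ I, wτ I = if (∃ v : HeightOneSpectrum (𝓞 E), Algebra.IsUnramifiedIn (𝓞 N) v.asIdeal ∧
          ∃ k : ℕ, I = v.asIdeal ^ k ∧ galFrob E N v ^ k = τ) then 1 else 0) →
        ∀ x η : ℝ, ThornerZaman.condQn N ^ a₁ ≤ x → 0 < η → η ≤ Real.log 2 →
          Real.exp (-(θ / 8) * Real.log x) ≤ 2 * η →
        ∀ lo hi : ℝ, Real.log x ≤ lo → lo < hi → hi ≤ Real.log x + η →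
          (¬ ∃ β₁ : ℝ, dedekindZeta₁ N β₁ = 0 ∧
            1 - c / (Real.log ((NumberField.discr N).natAbs : ℝ) + Real.log 4) < β₁ ∧ β₁ < 1) →
          ‖(Module.finrank E N : ℂ) *
                ((∑' k : ℕ, (∑ I ∈ idealsOfNorm E k, wτ I * idealVonMangoldt I) *
                  windowTest lo hi (ε₀ * η) (Real.log k) : ℝ) : ℂ) -
              fordLaplace (windowTest lo hi (ε₀ * η)) (-1)‖ ≤
            κ * x * η + n₀ * ((NumberField.discr N).natAbs.primeFactors.card) * (Real.log x + 2)) ∧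
      (∀ β₁ : ℝ, dedekindZeta₁ N β₁ = 0 →
          1 - c / (Real.log ((NumberField.discr N).natAbs : ℝ) + Real.log 4) < β₁ → β₁ < 1 →
        ∀ x η : ℝ, ThornerZaman.condQn N ^ a₁ ≤ x → 0 < η → η ≤ Real.log 2 →
          Real.exp (-(θ / 8) * Real.log x) ≤ 2 * η →
        ∀ lo hi : ℝ, Real.log x ≤ lo → lo < hi → hi ≤ Real.log x + η →
        ∃ j₀ : ℕ, j₀ < Module.finrank E N ∧
        ∀ (τ : N ≃ₐ[E] N) (wτ : Ideal (𝓞 E) → ℝ),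
          (∀ I, wτ I = if (∃ v : HeightOneSpectrum (𝓞 E), Algebra.IsUnramifiedIn (𝓞 N) v.asIdeal ∧
            ∃ k : ℕ, I = v.asIdeal ^ k ∧ galFrob E N v ^ k = τ) then 1 else 0) →
            ‖(Module.finrank E N : ℂ) *
                  ((∑' k : ℕ, (∑ I ∈ idealsOfNorm E k, wτ I * idealVonMangoldt I) *
                    windowTest lo hi (ε₀ * η) (Real.log k) : ℝ) : ℂ) -
                fordLaplace (windowTest lo hi (ε₀ * η)) (-1) +
                (((χ₁ τ : ℂˣ) : ℂ)⁻¹) ^ j₀ * fordLaplace (windowTest lo hi (ε₀ * η)) (-(β₁ : ℂ))‖ ≤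
              κ * x * η + n₀ * ((NumberField.discr N).natAbs.primeFactors.card) * (Real.log x + 2)) ∧
      (∀ β₁ : ℝ, dedekindZeta₁ N β₁ = 0 →
          1 - c' / (Real.log ((NumberField.discr N).natAbs : ℝ) + Real.log 4) < β₁ → β₁ < 1 →
        ∃ j₀ : ℕ, j₀ < Module.finrank E N ∧ (j₀ = 0 ↔ dedekindZeta₁ E β₁ = 0) ∧
        (∀ τ : N ≃ₐ[E] N, ((((χ₁ τ : ℂˣ) : ℂ)) ^ j₀) ^ 2 = 1) ∧
        ∀ (τ : N ≃ₐ[E] N) (wτ : Ideal (𝓞 E) → ℝ),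
          (∀ I, wτ I = if (∃ v : HeightOneSpectrum (𝓞 E), Algebra.IsUnramifiedIn (𝓞 N) v.asIdeal ∧
            ∃ k : ℕ, I = v.asIdeal ^ k ∧ galFrob E N v ^ k = τ) then 1 else 0) →
          ∀ x η : ℝ, ThornerZaman.condQn N ^ a₁ ≤ x → 0 < η → η ≤ Real.log 2 →
            Real.exp (-(θ / 8) * Real.log x) ≤ 2 * η →
          ∀ lo hi : ℝ, Real.log x ≤ lo → lo < hi → hi ≤ Real.log x + η →
            ‖(Module.finrank E N : ℂ) *
                  ((∑' k : ℕ, (∑ I ∈ idealsOfNorm E k, wτ I * idealVonMangoldt I) *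
                    windowTest lo hi (ε₀ * η) (Real.log k) : ℝ) : ℂ) -
                fordLaplace (windowTest lo hi (ε₀ * η)) (-1) +
                (((χ₁ τ : ℂˣ) : ℂ)⁻¹) ^ j₀ * fordLaplace (windowTest lo hi (ε₀ * η)) (-(β₁ : ℂ))‖ ≤
              κ * x * η + n₀ * ((NumberField.discr N).natAbs.primeFactors.card) * (Real.log x + 2)) := by
  classical
  obtain ⟨c₀, hc₀, hpack⟩ := exists_exceptionalZero_const n₀
  obtain ⟨A, -, hA⟩ := Residue.residueLowerBound_all n₀
  obtain ⟨b, D, hb, hD, hdens⟩ := fam_density_local n₀ hn₀ A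
  have ha : (1 : ℝ) ≤ max A 4 := le_trans (by norm_num) (le_max_right _ _)
  obtain ⟨θ, a₁, c, hθ0, hθ1, ha₁1, hc, hcn, hmain⟩ :=
    frobWindow_dichotomy n₀ hn₀ hb hD ha hκ hε₀ hε₀1
  set c' : ℝ := min c c₀ with hc'def
  have hc'0 : 0 < c' := lt_min hc hc₀
  have hc'c : c' ≤ c := min_le_left _ _
  have hc'c₀ : c' ≤ c₀ := min_le_right _ _
  refine ⟨θ, a₁, c, c', hθ0, hθ1, ha₁1, hc, hcn, hc'0, hc'c, ?_⟩
  intro E N _ _ _ _ _ _ _ hNn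
  haveI : FiniteDimensional E N := Module.Finite.of_restrictScalars_finite ℚ E N
  obtain ⟨χ₁, 𝔣, χ, p, L, hχ₁, hdata, hsupp, hval, h𝔣0, hχ0, hnt, -, hdisc, hL, -, hord⟩ :=
    CyclicExtension.exists_primitive_heckeFactorisation E N
  set m : ℕ := Module.finrank E N with hm
  have hm1 : 1 ≤ m := Module.finrank_pos
  have hdeg : Module.finrank ℚ N = Module.finrank ℚ E * m := (Module.finrank_mul_finrank ℚ E N).symm
  have hcard : Nat.card (N ≃ₐ[E] N) = m := IsGalois.card_aut_eq_finrank E N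
  have hN : 1 < Module.finrank ℚ N := by rw [hNn]; exact hn₀
  -- sizes
  set Q : ℝ := ThornerZaman.condQn N with hQ
  have hQ12 : (12 : ℝ) ≤ Q := ThornerZaman.twelve_le_condQn (K := N) hN
  have hQ1 : (1 : ℝ) < Q := by linarith
  -- `j ∈ Ico 1 m ⇒ ¬ m ∣ j`
  have hndvd : ∀ j ∈ Finset.Ico 1 m, ¬ m ∣ j := by
    intro j hj hdvd
    rw [Finset.mem_Ico] at hj
    exact absurd (Nat.le_of_dvd (by omega) hdvd) (by omega)
  -- the dual continuations
  have hex' : ∀ j, ∃ L' : ℂ → ℂ, j ∈ Finset.Ico 1 m →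
      Differentiable ℂ L' ∧ ∀ s : ℂ, 1 < s.re → L' s = rayClassLSeries (𝔣 j) (star (χ j)) s := by
    intro j
    by_cases hj : j ∈ Finset.Ico 1 m
    · obtain ⟨v, hv, hv1⟩ := hnt j (hndvd j hj)
      have hnt' : ∃ v : HeightOneSpectrum (𝓞 E), ¬ 𝔣 j ≤ v.asIdeal ∧ (star (χ j)) v ≠ 1 := by
        refine ⟨v, hv, fun h ↦ hv1 ?_⟩
        rw [Pi.star_apply, Complex.star_def] at h
        have := congrArg (starRingEnd ℂ) h
        rwa [Complex.conj_conj, map_one] at this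
      obtain ⟨L', hL'd, hL's⟩ := exists_differentiable_eq_rayClassLSeries (hdata j).1 (hdata j).2.1.star hnt'
      exact ⟨L', fun _ ↦ ⟨hL'd, hL's⟩⟩
    · exact ⟨fun _ ↦ 0, fun h ↦ absurd h hj⟩
  choose L' hL' using hex'
  -- conductor–discriminant consequences
  have hdN0 : 0 < (NumberField.discr N).natAbs := Int.natAbs_pos.mpr (NumberField.discr_ne_zero N)
  have hfac : ∀ j ∈ Finset.range m, (NumberField.discr E).natAbs * Ideal.absNorm (𝔣 j) ≤ (NumberField.discr N).natAbs :=
    fun j hj ↦ Nat.le_of_dvd hdN0 (hdisc ▸ Finset.dvd_prod_of_mem _ hj)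
  have hcond : ∀ j ∈ Finset.Ico 1 m, |(NumberField.discr E : ℝ)| * (Ideal.absNorm (𝔣 j) : ℝ) ≤ (NumberField.discr N).natAbs := by
    intro j hj
    have h := hfac j (Finset.mem_range.mpr (Finset.mem_Ico.mp hj).2)
    rw [← Int.cast_abs, ← Nat.cast_natAbs]
    exact_mod_cast h
  have hdE : ((NumberField.discr E).natAbs : ℝ) ≤ (NumberField.discr N).natAbs := by
    have h := hfac 0 (Finset.mem_range.mpr hm1)
    rw [h𝔣0, Ideal.absNorm_top, mul_one] at h
    exact_mod_cast h
  have hLIco : ∀ j ∈ Finset.Ico 1 m, Differentiable ℂ (L j) ∧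
      ∀ s : ℂ, 1 < s.re → L j s = rayClassLSeries (𝔣 j) (χ j) s := fun j hj ↦ hL j (hndvd j hj)
  have hntIco : ∀ j ∈ Finset.Ico 1 m, ∃ v : HeightOneSpectrum (𝓞 E), ¬ 𝔣 j ≤ v.asIdeal ∧ χ j v ≠ 1 :=
    fun j hj ↦ hnt j (hndvd j hj)
  -- the Deuring-twisted window dichotomy
  have hdich := hmain E N hNn (hdens N hNn (hA N hNn)) m hm1 hdeg 𝔣 χ p L L' hdata hntIco hLIco
    (fun j hj ↦ hL' j hj) hord h𝔣0 hχ0 hcond hdE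
  -- the Deuring coefficient identity and the ramified junk
  set wr : Ideal (𝓞 E) → ℝ := fun I ↦ if (∃ v : HeightOneSpectrum (𝓞 E), ¬ Algebra.IsUnramifiedIn (𝓞 N) v.asIdeal ∧
      ∃ k : ℕ, 0 < k ∧ I = v.asIdeal ^ k) then 1 else 0 with hwrdef
  have hwr : ∀ I, wr I = if (∃ v : HeightOneSpectrum (𝓞 E), ¬ Algebra.IsUnramifiedIn (𝓞 N) v.asIdeal ∧
      ∃ k : ℕ, 0 < k ∧ I = v.asIdeal ^ k) then 1 else 0 := fun I ↦ rfl
  have hray : ∀ j, 𝔣 j ≠ ⊥ ∧ IsRayClassCharacter (𝔣 j) (χ j) := fun j ↦ ⟨(hdata j).1, (hdata j).2.1⟩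
  have hjunk : ∀ (τ : N ≃ₐ[E] N) (wτ : Ideal (𝓞 E) → ℝ),
      (∀ I, wτ I = if (∃ v : HeightOneSpectrum (𝓞 E), Algebra.IsUnramifiedIn (𝓞 N) v.asIdeal ∧
        ∃ k : ℕ, I = v.asIdeal ^ k ∧ galFrob E N v ^ k = τ) then 1 else 0) →
      ∀ x η : ℝ, Q ^ a₁ ≤ x → 0 < η → η ≤ Real.log 2 →
      ∀ lo hi : ℝ, Real.log x ≤ lo → lo < hi → hi ≤ Real.log x + η →
      ‖∑ j ∈ Finset.range m, (((χ₁ τ : ℂˣ) : ℂ)⁻¹) ^ j * coefFordK (rcCoef (𝔣 j) (χ j)) (windowTest lo hi (ε₀ * η)) 0 -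
          (m : ℂ) * ((∑' k : ℕ, (∑ I ∈ idealsOfNorm E k, wτ I * idealVonMangoldt I) *
            windowTest lo hi (ε₀ * η) (Real.log k) : ℝ) : ℂ)‖ ≤
        n₀ * ((NumberField.discr N).natAbs.primeFactors.card) * (Real.log x + 2) := by
    intro τ wτ hwτ x η hx hη0 hη1 lo hi hlo hlohi hhi
    have hxQ : Q ≤ x := by
      have : Q ^ (1 : ℝ) ≤ Q ^ a₁ := Real.rpow_le_rpow_of_exponent_le hQ1.le ha₁1
      rw [Real.rpow_one] at this; linarith
    have hx1 : 1 < x := by linarith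
    have hx0 : 0 < x := by linarith
    have hL0 : 0 < Real.log x := Real.log_pos hx1
    set ε : ℝ := ε₀ * η with hε
    have hε0 : 0 < ε := by positivity
    have hlog2 : Real.log 2 < 0.6931471808 := Real.log_two_lt_d9
    have hε1 : ε ≤ 1 := by
      rw [hε]; have := mul_le_mul hε₀1 hη1 hη0.le (by norm_num); linarith
    have h1 := norm_sum_coefFordK_sub_le hχ₁ hcard hray hsupp hval τ hwτ hwr
      (g := windowTest lo hi ε) (X := hi + ε) (fun u hu ↦ windowTest_eq_zero_of_ge hε0 hu)
    have habs : ∀ k : ℕ, |windowTest lo hi ε (Real.log k)| = windowTest lo hi ε (Real.log k) :=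
      fun k ↦ abs_of_nonneg (windowTest_nonneg _ _ _ _)
    simp_rw [habs] at h1
    have hw0 : ∀ I, 0 ≤ wr I := fun I ↦ by rw [hwr I]; split_ifs <;> norm_num
    have h2 := smoothedPsiWeighted_le_psiWeighted_exp (K := E) (w := wr) hw0 (g := windowTest lo hi ε) (X := hi + ε)
      (fun u ↦ windowTest_mem_Icc _ _ _ u) (fun u hu ↦ windowTest_eq_zero_of_ge hε0 hu)
    have hy : (1 : ℝ) ≤ Real.exp (hi + ε) := Real.one_le_exp (by linarith)
    have h3 := psiWeighted_ram_le (E := E) (N := N) hwr hy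
    rw [Real.log_exp] at h3
    have hω0 : (0 : ℝ) ≤ ((NumberField.discr N).natAbs.primeFactors.card : ℝ) := Nat.cast_nonneg _
    have hnE0 : (0 : ℝ) ≤ Module.finrank ℚ E := Nat.cast_nonneg _
    have h4 : (m : ℝ) * (∑' k : ℕ, (∑ I ∈ idealsOfNorm E k, wr I * idealVonMangoldt I) * windowTest lo hi ε (Real.log k)) ≤
        n₀ * ((NumberField.discr N).natAbs.primeFactors.card) * (Real.log x + 2) := by
      have hm0 : (0 : ℝ) ≤ m := Nat.cast_nonneg _
      calc (m : ℝ) * (∑' k : ℕ, (∑ I ∈ idealsOfNorm E k, wr I * idealVonMangoldt I) * windowTest lo hi ε (Real.log k))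
          ≤ m * (Module.finrank ℚ E * ((NumberField.discr N).natAbs.primeFactors.card) * (hi + ε)) :=
            mul_le_mul_of_nonneg_left (h2.trans h3) hm0
        _ = n₀ * ((NumberField.discr N).natAbs.primeFactors.card) * (hi + ε) := by
            rw [← hNn, hdeg]; push_cast; ring
        _ ≤ n₀ * ((NumberField.discr N).natAbs.primeFactors.card) * (Real.log x + 2) := by
            refine mul_le_mul_of_nonneg_left (by linarith) (by positivity)
    exact h1.trans h4
  -- the window comparison `c' ≤ c`, `c' ≤ c₀`
  have hlogd0 : 0 ≤ Real.log ((NumberField.discr N).natAbs : ℝ) := Real.log_natCast_nonneg _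
  have hlog4 : 0 < Real.log 4 := Real.log_pos (by norm_num)
  have hwin_mono : ∀ {c₁ c₂ β₁ : ℝ}, c₁ ≤ c₂ →
      1 - c₁ / (Real.log ((NumberField.discr N).natAbs : ℝ) + Real.log 4) < β₁ →
      1 - c₂ / (Real.log ((NumberField.discr N).natAbs : ℝ) + Real.log 4) < β₁ := by
    intro c₁ c₂ β₁ h12 h
    have := div_le_div_of_nonneg_right h12 (by linarith : 0 ≤ Real.log ((NumberField.discr N).natAbs : ℝ) + Real.log 4)
    linarith
  -- the (B)-type conversion
  have hBconv : ∀ (β₁ : ℝ) (j₀ : ℕ) (x η lo hi : ℝ), Q ^ a₁ ≤ x → 0 < η → η ≤ Real.log 2 →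
      Real.log x ≤ lo → lo < hi → hi ≤ Real.log x + η →
      (∀ (cc : ℂ), ‖cc‖ ≤ 1 →
        ‖∑ j ∈ Finset.range m, cc ^ j * coefFordK (rcCoef (𝔣 j) (χ j)) (windowTest lo hi (ε₀ * η)) 0 -
            fordLaplace (windowTest lo hi (ε₀ * η)) (-1) +
            cc ^ j₀ * fordLaplace (windowTest lo hi (ε₀ * η)) (-(β₁ : ℂ))‖ ≤ κ * x * η) →
      ∀ (τ : N ≃ₐ[E] N) (wτ : Ideal (𝓞 E) → ℝ),
        (∀ I, wτ I = if (∃ v : HeightOneSpectrum (𝓞 E), Algebra.IsUnramifiedIn (𝓞 N) v.asIdeal ∧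
          ∃ k : ℕ, I = v.asIdeal ^ k ∧ galFrob E N v ^ k = τ) then 1 else 0) →
          ‖(m : ℂ) * ((∑' k : ℕ, (∑ I ∈ idealsOfNorm E k, wτ I * idealVonMangoldt I) *
                windowTest lo hi (ε₀ * η) (Real.log k) : ℝ) : ℂ) -
              fordLaplace (windowTest lo hi (ε₀ * η)) (-1) +
              (((χ₁ τ : ℂˣ) : ℂ)⁻¹) ^ j₀ * fordLaplace (windowTest lo hi (ε₀ * η)) (-(β₁ : ℂ))‖ ≤
            κ * x * η + n₀ * ((NumberField.discr N).natAbs.primeFactors.card) * (Real.log x + 2) := by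
    intro β₁ j₀ x η lo hi hx hη0 hη1 hlo hlohi hhi hB τ wτ hwτ
    have hB' := hB (((χ₁ τ : ℂˣ) : ℂ)⁻¹) (norm_inv_character_le_one χ₁ τ)
    have hJ := hjunk τ wτ hwτ x η hx hη0 hη1 lo hi hlo hlohi hhi
    set T : ℂ := ((m : ℂ) * ((∑' k : ℕ, (∑ I ∈ idealsOfNorm E k, wτ I * idealVonMangoldt I) *
        windowTest lo hi (ε₀ * η) (Real.log k) : ℝ) : ℂ)) with hT
    set S : ℂ := ∑ j ∈ Finset.range m, (((χ₁ τ : ℂˣ) : ℂ)⁻¹) ^ j *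
        coefFordK (rcCoef (𝔣 j) (χ j)) (windowTest lo hi (ε₀ * η)) 0 with hS
    set F1 : ℂ := fordLaplace (windowTest lo hi (ε₀ * η)) (-1) with hF1
    set Fβ : ℂ := (((χ₁ τ : ℂˣ) : ℂ)⁻¹) ^ j₀ * fordLaplace (windowTest lo hi (ε₀ * η)) (-(β₁ : ℂ)) with hFβ
    have he : T - F1 + Fβ = (S - F1 + Fβ) + (T - S) := by ring
    rw [he]
    refine (norm_add_le _ _).trans ?_
    rw [norm_sub_rev] at hJ
    linarith
  refine ⟨χ₁, hχ₁, fun τ wτ hwτ x η hx hη0 hη1 hηx lo hi hlo hlohi hhi hnoexc ↦ ?_,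
    fun β₁ hζ hwin hβ1 x η hx hη0 hη1 hηx lo hi hlo hlohi hhi ↦ ?_, fun β₁ hζ hwin hβ1 ↦ ?_⟩
  · -- (A)
    obtain ⟨hcaseA, -⟩ := hdich x η hx hη0 hη1 hηx lo hi hlo hlohi hhi
    have hA' := hcaseA (((χ₁ τ : ℂˣ) : ℂ)⁻¹) (norm_inv_character_le_one χ₁ τ) hnoexc
    have hJ := hjunk τ wτ hwτ x η hx hη0 hη1 lo hi hlo hlohi hhi
    have := norm_sub_le_norm_sub_add_norm_sub
      ((m : ℂ) * ((∑' k : ℕ, (∑ I ∈ idealsOfNorm E k, wτ I * idealVonMangoldt I) *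
        windowTest lo hi (ε₀ * η) (Real.log k) : ℝ) : ℂ))
      (∑ j ∈ Finset.range m, (((χ₁ τ : ℂˣ) : ℂ)⁻¹) ^ j *
        coefFordK (rcCoef (𝔣 j) (χ j)) (windowTest lo hi (ε₀ * η)) 0)
      (fordLaplace (windowTest lo hi (ε₀ * η)) (-1))
    rw [norm_sub_rev] at hJ
    linarith
  · -- (B)
    obtain ⟨-, hcaseB⟩ := hdich x η hx hη0 hη1 hηx lo hi hlo hlohi hhi
    obtain ⟨j₀, hj₀m, -, hB⟩ := hcaseB β₁ hζ hwin hβ1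
    exact ⟨j₀, hj₀m, hBconv β₁ j₀ x η lo hi hx hη0 hη1 hlo hlohi hhi hB⟩
  · -- (B'): the signed version in the `c'`-window, one index for all windows
    -- `β₁` is a simple zero of `ζ₁_N` (Landau–Page, constant `c₀ ≥ c'`)
    obtain ⟨-, -, hLPsimple⟩ := hpack N hNn
    have hβim : ((β₁ : ℂ)).im = 0 := Complex.ofReal_im β₁
    have hZ : (((1 : ClassGroup (𝓞 N) →* ℂˣ) = 1 → dedekindZeta₁ N β₁ = 0) ∧
        ((1 : ClassGroup (𝓞 N) →* ℂˣ) ≠ 1 → classGroupLFunction₀ N 1 β₁ = 0)) ∧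
        1 - c₀ / (Real.log ((NumberField.discr N).natAbs : ℝ) + Real.log (|((β₁ : ℂ)).im| + 4)) <
          ((β₁ : ℂ)).re := by
      refine ⟨⟨fun _ ↦ hζ, fun h ↦ absurd rfl h⟩, ?_⟩
      rw [hβim, abs_zero, zero_add, Complex.ofReal_re]
      exact hwin_mono hc'c₀ hwin
    have hsimple' : analyticOrderAt (dedekindZeta₁ N) β₁ = 1 := (hLPsimple 1 β₁ hZ).1 rfl
    have hsimple : analyticOrderNatAt (dedekindZeta₁ N) β₁ = 1 := by
      rw [analyticOrderNatAt, hsimple']; rfl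
    have hβ0 : 0 < β₁ := by
      have hlog4' : 1 < Real.log 4 := by
        rw [show (4:ℝ) = 2 ^ 2 by norm_num, Real.log_pow]; have := Real.log_two_gt_d9; push_cast; linarith
      have hc1 : c' ≤ 1 := by
        refine hc'c.trans (hcn.trans ?_)
        rw [div_le_one (by positivity)]
        have : (0 : ℝ) ≤ (n₀ : ℝ) ^ 2 := sq_nonneg _
        linarith
      have h1 : c' / (Real.log ((NumberField.discr N).natAbs : ℝ) + Real.log 4) ≤ 1 := by
        rw [div_le_one (by linarith)]; linarith
      linarith
    -- the canonical index
    have hsum1 : analyticOrderNatAt (dedekindZeta₁ E) β₁ + ∑ j ∈ Finset.Ico 1 m, analyticOrderNatAt (L j) β₁ = 1 := by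
      rw [← hord]; exact hsimple
    obtain ⟨j₀, hj₀m, hwhich, -⟩ := exists_carrier_index (o := fun j ↦ analyticOrderNatAt (L j) β₁) hm1 hsum1
    refine ⟨j₀, hj₀m, ?_, ?_, fun τ wτ hwτ x η hx hη0 hη1 hηx lo hi hlo hlohi hhi ↦ ?_⟩
    · rcases hwhich with ⟨hj0, hordE⟩ | ⟨hjpos, hordL⟩
      · exact ⟨fun _ ↦ dedekindZeta₁_eq_zero_of_order_one hordE, fun _ ↦ hj0⟩
      · have hj₀mem : j₀ ∈ Finset.Ico 1 m := Finset.mem_Ico.mpr ⟨hjpos, hj₀m⟩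
        have hLz : L j₀ β₁ = 0 := apply_eq_zero_of_analyticOrderNatAt_ne_zero (by rw [hordL]; exact one_ne_zero)
        have hEne := heckeIndex_dedekindZeta₁_ne_zero (N := N) 𝔣 χ L (fun j ↦ ⟨(hdata j).1, (hdata j).2.1⟩)
          hntIco hLIco hord hsimple hj₀mem hLz
        exact ⟨fun h ↦ absurd h hjpos.ne', fun h ↦ absurd h hEne⟩
    · rcases hwhich with ⟨hj0, -⟩ | ⟨hjpos, hordL⟩
      · intro τ; rw [hj0, pow_zero, one_pow]
      · have hj₀mem : j₀ ∈ Finset.Ico 1 m := Finset.mem_Ico.mpr ⟨hjpos, hj₀m⟩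
        have hLz : L j₀ β₁ = 0 := apply_eq_zero_of_analyticOrderNatAt_ne_zero (by rw [hordL]; exact one_ne_zero)
        have h2 := heckeIndex_two_mul_eq hcard χ₁ 𝔣 χ p L hdata hval hntIco hLIco hord hβ0 hsimple hj₀mem hLz
        exact fun τ ↦ character_pow_sq_eq_one_of_two_mul χ₁ hcard h2 τ
    · -- the bound: the index produced for this window coincides with `j₀`
      obtain ⟨-, hcaseB⟩ := hdich x η hx hη0 hη1 hηx lo hi hlo hlohi hhi
      obtain ⟨j₁, hj₁m, hwhich₁, hB⟩ := hcaseB β₁ hζ (hwin_mono hc'c hwin) hβ1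
      have hjj : j₁ = j₀ := carrier_index_unique hsum1 hj₁m hj₀m hwhich₁ hwhich
      subst hjj
      exact hBconv β₁ j₁ x η lo hi hx hη0 hη1 hlo hlohi hhi hB τ wτ hwτ

end Summit.QuantumAdvantage.QuantumAdvantage.Theorems.DegreeOnePrimesEscape

end
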